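import Mathlib
import Literature.Combinatorics.Additive.TripleProductProperty
import Summits.MatrixMultiplication.MatrixMultiplication.Theorems.SnSubsetDichotomyPolynomialSlackCosetFibring
import Summits.MatrixMultiplication.MatrixMultiplication.Theorems.SnSubsetDichotomyPolynomialSlackPrintRegime

/-!
# Common-value fibring cap for TPP triples in `S_n`

Crux `Summit.MatrixMultiplication.MatrixMultiplication.Theses.SnSubsetDichotomy.PolynomialSlack`
(item `stmt-MatrixMultiplication-8306`), helper file of lead c5 (line `transport-split-hull`), the
"fibring cap" of the level-one programme: when two members of a TPP triple `(S, T, U)` of `S_n` are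
restricted to point bumps `{s : s i = v}`, `{t : t j = v}` at a COMMON value `v`, fibring over the
stabiliser `Stab(v) ≅ S_{n-1}` (`tpp_card_mul_mul_le_pointFibres`) loses only the lift rate `n`:

* `commonValue_volume_le` — `|S ∩ {s i = v}|·|T ∩ {t j = v}|·|U| ≤ n · B` for every bound `B` on TPP
  volumes in `S_{n-1}` (the two restricted members have a single `v`-preimage each, `U` has at most `n`);
* `commonValue_volume_le_three` — with all THREE members restricted at the common value the rate is one:
  `|S ∩ {s i = v}|·|T ∩ {t j = v}|·|U ∩ {u k = v}| ≤ B`;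
* `commonValue_volume_le_explicit` — the first bound with the explicit BCGPU value
  `B = ⌊((n-1)!)^{3/2}/√⌊(n-1)/4⌋ + (n-1)!⌋` (`tpp_volume_le_perm` one dimension down, `n ≥ 6`).
-/

namespace Summit.MatrixMultiplication.MatrixMultiplication.Theorems.PolynomialSlack

open scoped BigOperators
open Finset
open Literature.Combinatorics.Additive (TripleProductProperty)

set_option linter.dupNamespace false

/-- A point bump `{x ∈ X : x i = v}` has a single `v`-preimage: its image under `x ↦ x⁻¹ v` lies in
`{i}`, so has at most one element. [folklore] -/
theorem card_image_inv_apply_filter_le_one {n : ℕ} (X : Finset (Equiv.Perm (Fin n)))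
    (i v : Fin n) : ((X.filter fun x => x i = v).image fun x => x⁻¹ v).card ≤ 1 := by
  refine (card_le_card ?_).trans (card_singleton i).le
  intro a ha
  simp only [mem_image, mem_filter] at ha
  obtain ⟨x, ⟨-, hx⟩, rfl⟩ := ha
  exact mem_singleton.2 (Equiv.Perm.inv_eq_iff_eq.2 hx.symm)

/-- Any set of permutations of `Fin n` has at most `n` distinct `v`-preimages. [folklore] -/
theorem card_image_inv_apply_le {n : ℕ} (X : Finset (Equiv.Perm (Fin n))) (v : Fin n) :
    (X.image fun x => x⁻¹ v).card ≤ n :=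
  (card_le_univ _).trans (Fintype.card_fin n).le

/-- **Fibring cap (abstract bound one dimension down).** If `B` bounds the volume `|S'||T'||U'|` of
every TPP triple of `S_{n-1}`, then for every TPP triple `(S, T, U)` of `S_n`, every value `v` and all
positions `i, j`: `|{s ∈ S : s i = v}|·|{t ∈ T : t j = v}|·|U| ≤ n · B` — point fibring over `Stab(v)`
(`tpp_card_mul_mul_le_pointFibres`) applied to the sub-triple, whose first two members have exactly one
`v`-preimage (`i`, resp. `j`) while `U` has at most `n`. [folklore] -/
theorem commonValue_volume_le {n : ℕ} (v : Fin n) (B : ℕ)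
    (hB : ∀ S' T' U' : Finset (Equiv.Perm (Fin (n - 1))), TripleProductProperty S' T' U' →
      S'.card * T'.card * U'.card ≤ B)
    {S T U : Finset (Equiv.Perm (Fin n))} (h : TripleProductProperty S T U) (i j : Fin n) :
    (S.filter fun s => s i = v).card * (T.filter fun t => t j = v).card * U.card ≤ n * B := by
  have hsub : TripleProductProperty (S.filter fun s => s i = v) (T.filter fun t => t j = v) U :=
    h.mono (filter_subset _ _) (filter_subset _ _) subset_rfl
  have hS := card_image_inv_apply_filter_le_one S i v
  have hT := card_image_inv_apply_filter_le_one T j v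
  have hU := card_image_inv_apply_le U v
  calc (S.filter fun s => s i = v).card * (T.filter fun t => t j = v).card * U.card
      ≤ ((S.filter fun s => s i = v).image fun x => x⁻¹ v).card *
          ((T.filter fun t => t j = v).image fun x => x⁻¹ v).card *
          (U.image fun x => x⁻¹ v).card * B := tpp_card_mul_mul_le_pointFibres v B hB hsub
    _ ≤ 1 * 1 * n * B := Nat.mul_le_mul (Nat.mul_le_mul (Nat.mul_le_mul hS hT) hU) le_rfl
    _ = n * B := by ring

/-- From `a ≤ n · ⌊r⌋₊` in `ℕ` to `a ≤ n · r` in `ℝ`, for `r ≥ 0`. [folklore] -/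
theorem cast_le_mul_of_le_mul_natFloor {a n : ℕ} {r : ℝ} (hr : 0 ≤ r) (h : a ≤ n * ⌊r⌋₊) :
    (a : ℝ) ≤ n * r :=
  calc (a : ℝ) ≤ ((n * ⌊r⌋₊ : ℕ) : ℝ) := by exact_mod_cast h
    _ = (n : ℝ) * (⌊r⌋₊ : ℝ) := Nat.cast_mul _ _
    _ ≤ n * r := by gcongr; exact Nat.floor_le hr

/-- **Fibring cap, explicit (BCGPU one dimension down).** For `n ≥ 6`, every TPP triple `(S, T, U)` of
`S_n`, every value `v` and all positions `i, j`:
`|{s ∈ S : s i = v}|·|{t ∈ T : t j = v}|·|U| ≤ n · (((n-1)!)^{3/2}/√⌊(n-1)/4⌋ + (n-1)!)` —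
`commonValue_volume_le` with `B = ⌊((n-1)!)^{3/2}/√⌊(n-1)/4⌋ + (n-1)!⌋`, a valid bound on TPP volumes
in `S_{n-1}` by `tpp_volume_le_perm` (`n - 1 ≥ 5`). [cite: BlasiakCohnGrochowPrattUmans2023, Thm. 3.2] -/
theorem commonValue_volume_le_explicit {n : ℕ} (hn : 6 ≤ n) (v : Fin n)
    {S T U : Finset (Equiv.Perm (Fin n))} (h : TripleProductProperty S T U) (i j : Fin n) :
    (((S.filter fun s => s i = v).card * (T.filter fun t => t j = v).card * U.card : ℕ) : ℝ) ≤
      n * (((n - 1).factorial : ℝ) ^ (3 / 2 : ℝ) / Real.sqrt (((n - 1) / 4 : ℕ) : ℝ) +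
        (n - 1).factorial) := by
  have hn' : 5 ≤ n - 1 := by omega
  refine cast_le_mul_of_le_mul_natFloor (by positivity) (commonValue_volume_le v _
    (fun S' T' U' h' => Nat.le_floor (tpp_volume_le_perm hn' S' T' U' h')) h i j)

/-- **Three members at a common value: rate one.** If `B` bounds the volume of every TPP triple of
`S_{n-1}`, then for every TPP triple `(S, T, U)` of `S_n`, every value `v` and all positions `i, j, k`:
`|{s ∈ S : s i = v}|·|{t ∈ T : t j = v}|·|{u ∈ U : u k = v}| ≤ B` — all three restricted members have a
single `v`-preimage, so point fibring over `Stab(v)` loses nothing. [folklore] -/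
theorem commonValue_volume_le_three {n : ℕ} (v : Fin n) (B : ℕ)
    (hB : ∀ S' T' U' : Finset (Equiv.Perm (Fin (n - 1))), TripleProductProperty S' T' U' →
      S'.card * T'.card * U'.card ≤ B)
    {S T U : Finset (Equiv.Perm (Fin n))} (h : TripleProductProperty S T U) (i j k : Fin n) :
    (S.filter fun s => s i = v).card * (T.filter fun t => t j = v).card *
      (U.filter fun u => u k = v).card ≤ B := by
  have hsub : TripleProductProperty (S.filter fun s => s i = v) (T.filter fun t => t j = v)
      (U.filter fun u => u k = v) :=
    h.mono (filter_subset _ _) (filter_subset _ _) (filter_subset _ _)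
  have hS := card_image_inv_apply_filter_le_one S i v
  have hT := card_image_inv_apply_filter_le_one T j v
  have hU := card_image_inv_apply_filter_le_one U k v
  calc (S.filter fun s => s i = v).card * (T.filter fun t => t j = v).card *
        (U.filter fun u => u k = v).card
      ≤ ((S.filter fun s => s i = v).image fun x => x⁻¹ v).card *
          ((T.filter fun t => t j = v).image fun x => x⁻¹ v).card *
          ((U.filter fun u => u k = v).image fun x => x⁻¹ v).card * B :=
        tpp_card_mul_mul_le_pointFibres v B hB hsub
    _ ≤ 1 * 1 * 1 * B := Nat.mul_le_mul (Nat.mul_le_mul (Nat.mul_le_mul hS hT) hU) le_rfl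
    _ = B := by ring

end Summit.MatrixMultiplication.MatrixMultiplication.Theorems.PolynomialSlack
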